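import Summits.QuantumFields.BalabanUV.Beta.GAN24.E3UnitSplitLevels

/-!
# `BalabanUV.Beta.GAN24.S3ShapeL0Contraction` — binder row G-an2-4 / (CONV-C), S-slot, road «S3-Taylor», SHAPE row **S3-L0**, part 1:
# THE VERTEX CONTRACTION OF THE LEVEL-0 Λ TABLE AND ITS SYNTHETIC SANDWICH PAIR (holder of ROW-Λ0: b2b-balaban-gan24-formalise-leaf-08,
# gen 11; INTENT CLAIMS l.4822; part 2 = `GAN24/S3ShapeL0`, the row assembly at `d = 3`)

NOT IN PRINT; OUR PROOF ATTEMPT.  HONEST FRAMING (cell contract, verbatim): «discharging `BetaPertH` makes Bałaban's UV stability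
UNCONDITIONAL — a real constructive-QFT result; it is NOT the continuum limit and NOT the Clay problem.»  HONEST DEPENDENCY (verbatim):
«continuum YM on T⁴ ⇐ BetaPertH ∧ nine spine estimates (0/9 proved); BetaPertH ⇐ (D1) ∧ (D4) ∧ CAP+tail; G-an2-4 gates asym, D1 and
NE2/3/4.»  [folklore] bookkeeping over an2's DEFINITIONS (`InterLevelTransport.SLam`∕`cwsum`∕`onLat`, `BalabanStepJets.lamCoeffOf`,
`OneStepResolventKernel.KInv`, `KernelSpecInstance.wH`) and an1's `AveragingHessianKernels.hessFF`∕`hessKer`∕`Near` BY NAME; generic `d`, any blocking `N`,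
fixed `Lc`; 0 `def`, 0 cite, 0 `Prop` mirror, 0 sorry; NO estimate beyond per-`N` existential decay (used only for summability).  Discharges NOTHING of
(hS, hSall) ∕ «E3Shape» ∕ «E3SupRate»; NOT BetaPertH, NOT continuum, NOT Clay.

## Why (row S3-L0's count; asserted nowhere below)
In the one-channel unit sandwich of `E3UnitSplitLevels.e3Lam0_unit_split` the vertex leg `H̃_N(κ″κ′; u − N•u′)` meets the level-0 table
`SLam Lc (lamCoeffOf (KInv Lc) Lc) hessFF κ″ u` ONLY through THE BRACKET `β(μ,yy) := Σ_{κ″} Σ'_u wH_N κ″ κ′ (u − N•u′)·lamCoeffOf (KInv Lc) Lc μ yy κ″ u`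
(one scalar per coarse bond of the `Lc`-lattice).  `TaylorSandwich.sandwich_bound` takes absolute values termwise in `u` and would lose the bracket's
cancellation; so the bracket is contracted FIRST and the result repackaged as a sandwich of the same literal shape with a SYNTHETIC vertex pair
carrying the contracted value — then the absolute sandwich bound applies verbatim (part 2).

## What is proved
§1 `SLam0_eq_finset_sum` (at a fixed field leg `w` the coarse-bond sum of the level-0 table is FINITE: `hessKer Lc μ yy` lives on `Near Lc yy`),
   `summable_wH_mul_lamCoeffOf` (the bracket's `u`-series converges absolutely, per-`N` existentials), **`inner_eq_onLat`** — THE VERTEX CONTRACTION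
   (kernel identity): `Σ_{κ″} c·Σ'_u (ν·wH_N κ″ κ′ (u − N•u′))·SLam … κ″ u w y (inl l) (inl l′) = Σ_μ c·Σ'_u H′ μ u · T′ μ u w l y l′` with
   `H′ μ u := onLat Lc (yy ↦ ν·β(μ,yy)) u`, `T′ μ u := onLat Lc (yy ↦ −hessFF Lc μ yy) u`.
§2 the synthetic table has FINITE COLUMN SUPPORT (`support_onLat_hessFF`: `w` and `u` in the radius-`2Lc` box of `y`), entries `≤ 2ℓ²`
   (`abs_onLat_hessFF_le`), an `N`-free COLUMN MASS (`mass_onLat_hessFF`), and the synthetic vertex leg IS the bracket bound (`leg_onLat`) —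
   the four table∕leg hypotheses of `TaylorSandwich.sandwich_bound`, literally.
-/

noncomputable section

open Finset
open scoped BigOperators
open Literature.MathematicalPhysics.QuantumFieldTheory
open Literature.MathematicalPhysics.QuantumFieldTheory.Balaban1983to89
open Literature.MathematicalPhysics.QuantumFieldTheory.Balaban1983to89.Beta
open Literature.Probability.LatticeModels (Torus.proj)
open B12Sec2to5 (l1 l1_nonneg)
open ExpKernelCalculus (MKer Zl BiLoc Decays)
open LatticeForm (quo)
open KernelSpecInstance (wH)
open KKTFluctuationKernel (GamΦ)
open OneStepResolventKernel (Fib LocStencil KInv)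
open AveragingHessianKernels (hessFF hessKer Near ell)
open InterLevelTransport (SLam cwsum cwsum_apply onLat onLat_zsmul onLat_off)
open BalabanStepJets (lamCoeffOf)

namespace Summit.QuantumFields.BalabanUV.Beta.GAN24.S3ShapeL0Contraction

variable {d : ℕ}

/-! ## §1 The vertex contraction: the multiplier-response leg enters only through the bracket -/

section Contraction

variable {N Lc : ℕ} [NeZero N] [NeZero Lc]

/-- [folklore] The minimiser column `wH_N` is bounded (per-`N` existential decay `KernelSpecInstance.decay_wH` suffices). -/
theorem exists_wH_bound : ∃ CH : ℝ, 0 ≤ CH ∧ ∀ (κ l : Fin (d + 1)) (z : Fin (d + 1) → ℤ), |wH (N := N) κ l z| ≤ CH := by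
  obtain ⟨δ₁, C₁, hδ₁, h⟩ := KernelSpecInstance.decay_wH (N := N) (d := d)
  have hC₁ : 0 ≤ C₁ := by
    have h0 := h 0 0 0
    have : Real.exp (-δ₁ * l1 (0 : Fin (d + 1) → ℤ)) = 1 := by simp [B12Sec2to5.l1]
    rw [this, mul_one] at h0
    exact (abs_nonneg _).trans h0
  refine ⟨C₁, hC₁, fun κ l z => (h κ l z).trans ?_⟩
  have : Real.exp (-δ₁ * l1 z) ≤ 1 := by
    rw [Real.exp_le_one_iff]
    nlinarith [l1_nonneg z]
  nlinarith

/-- [folklore] The multiplier-response coefficients at FIXED blocking `Lc` decay from their coarse bond (`abs_lamCoeffOf_le` +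
`decays_KInv (N := Lc)`; per-`Lc` existential constants). -/
theorem exists_lamCoeffOf_bound : ∃ K δ₀ : ℝ, 0 < δ₀ ∧ 0 ≤ K ∧ ∀ (μ : Fin (d + 1)) (yy : Fin (d + 1) → ℤ) (κ'' : Fin (d + 1))
    (u : Fin (d + 1) → ℤ), |lamCoeffOf (KInv (N := Lc) (d := d)) Lc μ yy κ'' u| ≤ K * Real.exp (-δ₀ * l1 (u - (Lc : ℤ) • yy)) := by
  obtain ⟨δ₀, C₀, hδ₀, hC₀, hK⟩ := OneStepResolventKernel.decays_KInv (N := Lc) (d := d)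
  refine ⟨(3 : ℝ) ^ (d + 1) * ((d + 1 : ℕ) : ℝ) * (16 * ((d + 1 : ℕ) : ℝ)) * C₀ * Real.exp (((d + 1 : ℕ) : ℝ) * δ₀), δ₀, hδ₀,
    by positivity, fun μ yy κ'' u => ?_⟩
  have h := BalabanStepJets.abs_lamCoeffOf_le (N := Lc) hK hC₀ hδ₀.le μ yy κ'' u
  rwa [ExpKernelCalculus.l1_sub_symm] at h

/-- [folklore] The bracket's `u`-series is absolutely summable (bounded column × decaying coefficients). -/
theorem summable_wH_mul_lamCoeffOf (κ'' κ' μ : Fin (d + 1)) (u' yy : Fin (d + 1) → ℤ) :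
    Summable fun u : Fin (d + 1) → ℤ =>
      wH (N := N) κ'' κ' (u - (N : ℤ) • u') * lamCoeffOf (KInv (N := Lc) (d := d)) Lc μ yy κ'' u := by
  obtain ⟨CH, hCH, hH⟩ := exists_wH_bound (N := N) (d := d)
  obtain ⟨K, δ₀, hδ₀, hK, hc⟩ := exists_lamCoeffOf_bound (Lc := Lc) (d := d)
  refine KKTFluctuationEnergy.summable_mul_of_bdd (M := CH) (fun u => hH κ'' κ' _) ?_
  exact KKTFluctuationEnergy.summable_of_exp_bound hδ₀ ((Lc : ℤ) • yy) (fun u => hc μ yy κ'' u)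

/-- [folklore] THE SUPPORT of the coarse-bond sum at a fixed field leg `w`: `Near Lc yy w` forces `yy` into the box
`∏ᵢ [quo Lc w i − 1, quo Lc w i]`. -/
theorem mem_nearBox_of_near {yy w : Fin (d + 1) → ℤ} (h : Near Lc yy w) :
    yy ∈ Fintype.piFinset fun i => Finset.Icc (quo Lc w i - 1) (quo Lc w i) := by
  rw [Fintype.mem_piFinset]
  intro i
  rw [Finset.mem_Icc]
  have hL : (0 : ℤ) < Lc := by exact_mod_cast Nat.pos_of_ne_zero (NeZero.ne Lc)
  obtain ⟨h1, h2⟩ := h i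
  have hq : quo Lc w i = w i / (Lc : ℤ) := rfl
  constructor
  · rw [hq]
    have : w i / (Lc : ℤ) < yy i + 2 := by
      rw [Int.ediv_lt_iff_lt_mul hL]
      linarith
    omega
  · rw [hq]
    exact Int.le_ediv_of_mul_le hL (by linarith)

/-- [folklore] Off the box the constraint Hessian of the coarse bond `(μ, yy)` does not see the field leg `w`. -/
theorem hessFF_eq_zero_of_not_mem {yy w : Fin (d + 1) → ℤ}
    (h : yy ∉ Fintype.piFinset fun i => Finset.Icc (quo Lc w i - 1) (quo Lc w i)) (μ : Fin (d + 1))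
    (y : Fin (d + 1) → ℤ) (l l' : Fin (d + 1)) : hessFF Lc μ yy w y (Sum.inl l) (Sum.inl l') = 0 := by
  rw [AveragingHessianKernels.hessFF_inl_inl]
  exact AveragingHessianKernels.hessKer_eq_zero_left (f := (l, w)) (fun hn => h (mem_nearBox_of_near hn)) _

/-- [folklore] **THE LEVEL-0 Λ TABLE AT A FIXED FIELD LEG IS A FINITE COARSE-BOND SUM**:
`SLam Lc c hessFF κ″ u w y (inl l) (inl l′) = −Σ_μ Σ_{yy ∈ box(w)} c μ yy κ″ u · hessFF Lc μ yy w y (inl l) (inl l′)`. -/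
theorem SLam0_eq_finset_sum (κ'' : Fin (d + 1)) (u w y : Fin (d + 1) → ℤ) (l l' : Fin (d + 1)) :
    SLam Lc (lamCoeffOf (KInv (N := Lc) (d := d)) Lc) (fun μ y => hessFF Lc μ y) κ'' u w y (Sum.inl l) (Sum.inl l') =
      -∑ μ : Fin (d + 1), ∑ yy ∈ Fintype.piFinset (fun i => Finset.Icc (quo Lc w i - 1) (quo Lc w i)),
        lamCoeffOf (KInv (N := Lc) (d := d)) Lc μ yy κ'' u * hessFF Lc μ yy w y (Sum.inl l) (Sum.inl l') := by
  simp only [SLam, cwsum_apply]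
  congr 1
  refine Finset.sum_congr rfl fun μ _ => ?_
  exact tsum_eq_sum fun yy hyy => by rw [hessFF_eq_zero_of_not_mem hyy, mul_zero]

/-- **THE VERTEX CONTRACTION** [folklore] (kernel identity, generic `d`, any blocking `N`, fixed `Lc`): in the one-channel unit
sandwich of the level-`0` Λ table the vertex leg `ν·wH_N κ″ κ′ (u − N•u′)` and the table `SLam Lc (lamCoeffOf (KInv Lc) Lc) hessFF`
can be replaced by the SYNTHETIC pair (supported on the coarse sublattice `Lc•ℤ^{d+1}`, fibre slot = the coarse direction `μ`)
`H′ μ u := onLat Lc (yy ↦ ν·β(μ,yy)) u`, `T′ μ u := onLat Lc (yy ↦ −hessFF Lc μ yy) u`, where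
`β(μ,yy) := Σ_{κ″} Σ'_v wH_N κ″ κ′ (v − N•u′)·lamCoeffOf (KInv Lc) Lc μ yy κ″ v` is THE BRACKET — without changing the value. -/
theorem inner_eq_onLat (ν c : ℝ) (κ' : Fin (d + 1)) (u' w y : Fin (d + 1) → ℤ) (l l' : Fin (d + 1)) :
    (∑ κ'' : Fin (d + 1), c * ∑' u : Fin (d + 1) → ℤ,
        (ν * wH (N := N) κ'' κ' (u - (N : ℤ) • u')) *
          SLam Lc (lamCoeffOf (KInv (N := Lc) (d := d)) Lc) (fun μ y => hessFF Lc μ y) κ'' u w y (Sum.inl l) (Sum.inl l')) =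
      ∑ μ : Fin (d + 1), c * ∑' u : Fin (d + 1) → ℤ,
        onLat Lc (fun yy => ν * ∑ κ'' : Fin (d + 1), ∑' v : Fin (d + 1) → ℤ,
            wH (N := N) κ'' κ' (v - (N : ℤ) • u') * lamCoeffOf (KInv (N := Lc) (d := d)) Lc μ yy κ'' v) u *
          onLat Lc (fun yy => -hessFF Lc μ yy) u w y (Sum.inl l) (Sum.inl l') := by
  set F : Finset (Fin (d + 1) → ℤ) := Fintype.piFinset (fun i => Finset.Icc (quo Lc w i - 1) (quo Lc w i)) with hF
  set lam := lamCoeffOf (KInv (N := Lc) (d := d)) Lc with hlam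
  -- LHS: finite coarse-bond sum pulled through the `u`-series
  have hL : ∀ κ'' : Fin (d + 1),
      ∑' u : Fin (d + 1) → ℤ, (ν * wH (N := N) κ'' κ' (u - (N : ℤ) • u')) *
          SLam Lc lam (fun μ y => hessFF Lc μ y) κ'' u w y (Sum.inl l) (Sum.inl l') =
        -∑ μ : Fin (d + 1), ∑ yy ∈ F, hessFF Lc μ yy w y (Sum.inl l) (Sum.inl l') *
          (ν * ∑' u : Fin (d + 1) → ℤ, wH (N := N) κ'' κ' (u - (N : ℤ) • u') * lam μ yy κ'' u) := by
    intro κ''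
    have hsum : ∀ μ yy, Summable fun u : Fin (d + 1) → ℤ =>
        hessFF Lc μ yy w y (Sum.inl l) (Sum.inl l') * (ν * (wH (N := N) κ'' κ' (u - (N : ℤ) • u') * lam μ yy κ'' u)) :=
      fun μ yy => ((summable_wH_mul_lamCoeffOf (N := N) (Lc := Lc) κ'' κ' μ u' yy).mul_left ν).mul_left _
    calc ∑' u : Fin (d + 1) → ℤ, (ν * wH (N := N) κ'' κ' (u - (N : ℤ) • u')) *
            SLam Lc lam (fun μ y => hessFF Lc μ y) κ'' u w y (Sum.inl l) (Sum.inl l')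
        = ∑' u : Fin (d + 1) → ℤ, -∑ μ : Fin (d + 1), ∑ yy ∈ F,
            hessFF Lc μ yy w y (Sum.inl l) (Sum.inl l') * (ν * (wH (N := N) κ'' κ' (u - (N : ℤ) • u') * lam μ yy κ'' u)) := by
          refine tsum_congr fun u => ?_
          rw [hlam, SLam0_eq_finset_sum, ← hlam, mul_neg, Finset.mul_sum]
          congr 1
          refine Finset.sum_congr rfl fun μ _ => ?_
          rw [Finset.mul_sum]
          exact Finset.sum_congr rfl fun yy _ => by ring
      _ = -∑ μ : Fin (d + 1), ∑ yy ∈ F, ∑' u : Fin (d + 1) → ℤ,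
            hessFF Lc μ yy w y (Sum.inl l) (Sum.inl l') * (ν * (wH (N := N) κ'' κ' (u - (N : ℤ) • u') * lam μ yy κ'' u)) := by
          rw [tsum_neg, Summable.tsum_finsetSum (fun μ _ => summable_sum fun yy _ => hsum μ yy)]
          congr 1
          exact Finset.sum_congr rfl fun μ _ => Summable.tsum_finsetSum fun yy _ => hsum μ yy
      _ = _ := by
          congr 1
          refine Finset.sum_congr rfl fun μ _ => Finset.sum_congr rfl fun yy _ => ?_
          rw [tsum_mul_left, tsum_mul_left]
  -- RHS: the synthetic pair is a `cwsum`, hence the coarse sum, hence the same finite sum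
  have hR : ∀ μ : Fin (d + 1),
      ∑' u : Fin (d + 1) → ℤ,
        onLat Lc (fun yy => ν * ∑ κ'' : Fin (d + 1), ∑' v : Fin (d + 1) → ℤ,
            wH (N := N) κ'' κ' (v - (N : ℤ) • u') * lam μ yy κ'' v) u *
          onLat Lc (fun yy => -hessFF Lc μ yy) u w y (Sum.inl l) (Sum.inl l') =
        ∑ yy ∈ F, (ν * ∑ κ'' : Fin (d + 1), ∑' v : Fin (d + 1) → ℤ,
            wH (N := N) κ'' κ' (v - (N : ℤ) • u') * lam μ yy κ'' v) * -hessFF Lc μ yy w y (Sum.inl l) (Sum.inl l') := by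
    intro μ
    have h1 := cwsum_apply (N := Lc) (fun yy => ν * ∑ κ'' : Fin (d + 1), ∑' v : Fin (d + 1) → ℤ,
        wH (N := N) κ'' κ' (v - (N : ℤ) • u') * lam μ yy κ'' v) (fun yy => -hessFF Lc μ yy) w y (Sum.inl l) (Sum.inl l')
    simp only [cwsum, OneStepResolventKernel.wsum] at h1
    rw [h1]
    refine tsum_eq_sum fun yy hyy => ?_
    rw [Pi.neg_apply, Pi.neg_apply, Pi.neg_apply, Pi.neg_apply, hessFF_eq_zero_of_not_mem hyy, neg_zero, mul_zero]
  simp_rw [hL, hR]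
  -- both sides are the same finite double sum
  rw [show (∑ κ'' : Fin (d + 1), c * -∑ μ : Fin (d + 1), ∑ yy ∈ F, hessFF Lc μ yy w y (Sum.inl l) (Sum.inl l') *
        (ν * ∑' u : Fin (d + 1) → ℤ, wH (N := N) κ'' κ' (u - (N : ℤ) • u') * lam μ yy κ'' u)) =
      ∑ μ : Fin (d + 1), c * ∑ yy ∈ F, ∑ κ'' : Fin (d + 1), -(hessFF Lc μ yy w y (Sum.inl l) (Sum.inl l') *
        (ν * ∑' u : Fin (d + 1) → ℤ, wH (N := N) κ'' κ' (u - (N : ℤ) • u') * lam μ yy κ'' u)) by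
    simp only [mul_neg, Finset.mul_sum, ← Finset.sum_neg_distrib]
    rw [Finset.sum_comm]
    refine Finset.sum_congr rfl fun μ _ => ?_
    rw [Finset.sum_comm]]
  refine Finset.sum_congr rfl fun μ _ => ?_
  congr 1
  refine Finset.sum_congr rfl fun yy _ => ?_
  rw [Finset.mul_sum, Finset.sum_mul]
  refine Finset.sum_congr rfl fun κ'' _ => ?_
  ring

end Contraction

/-! ## §2 The synthetic pair: finite column support, bounded column mass, vertex leg = the bracket bound -/

section Synthetic

variable {N Lc : ℕ} [NeZero N] [NeZero Lc]

/-- [folklore] THE COLUMN BOX of a field leg `y` (radius `R` in every coordinate). -/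
theorem mem_colBox_iff {R : ℤ} {y v : Fin (d + 1) → ℤ} :
    v ∈ Fintype.piFinset (fun i => Finset.Icc (y i - R) (y i + R)) ↔ ∀ i, y i - R ≤ v i ∧ v i ≤ y i + R := by
  simp only [Fintype.mem_piFinset, Finset.mem_Icc]

/-- [folklore] The column box has `(2R+1)^{d+1}` points (independently of `y`). -/
theorem card_colBox {R : ℕ} (y : Fin (d + 1) → ℤ) :
    (Fintype.piFinset (fun i => Finset.Icc (y i - (R : ℤ)) (y i + (R : ℤ)))).card = (2 * R + 1) ^ (d + 1) := by
  have h : ∀ i : Fin (d + 1), (Finset.Icc (y i - (R : ℤ)) (y i + (R : ℤ))).card = 2 * R + 1 := fun i => by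
    rw [Int.card_Icc]; omega
  rw [Fintype.card_piFinset]
  simp_rw [h]
  rw [Finset.prod_const, Finset.card_univ, Fintype.card_fin]

/-- [folklore] Points of the column box are `ℓ¹`-close to `y`: `|v − y|₁ ≤ (d+1)·R`. -/
theorem l1_le_of_mem_colBox {R : ℕ} {y v : Fin (d + 1) → ℤ}
    (hv : v ∈ Fintype.piFinset (fun i => Finset.Icc (y i - (R : ℤ)) (y i + (R : ℤ)))) :
    l1 (v - y) ≤ ((d : ℝ) + 1) * R := by
  rw [mem_colBox_iff] at hv
  unfold B12Sec2to5.l1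
  have h : ∀ i ∈ (Finset.univ : Finset (Fin (d + 1))), |(((v - y) i : ℤ) : ℝ)| ≤ (R : ℝ) := by
    intro i _
    obtain ⟨h1, h2⟩ := hv i
    rw [Pi.sub_apply, ← Int.cast_abs]
    have : |v i - y i| ≤ (R : ℤ) := by rw [abs_le]; constructor <;> omega
    exact_mod_cast this
  refine (Finset.sum_le_card_nsmul _ _ _ h).trans ?_
  rw [Finset.card_univ, Fintype.card_fin, nsmul_eq_mul]
  push_cast
  nlinarith

/-- [folklore] **FINITE COLUMN SUPPORT OF THE SYNTHETIC TABLE**: if `T′ μ u w l y l′ ≠ 0` then `u = Lc•yy` is a coarse point whose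
support box contains both field legs `w` and `y`; hence `w` and `u` lie in the column box of `y` of radius `2Lc`. -/
theorem support_onLat_hessFF {μ : Fin (d + 1)} {u w y : Fin (d + 1) → ℤ} {l l' : Fin (d + 1)}
    (h : onLat Lc (fun yy => -hessFF Lc μ yy) u w y (Sum.inl l) (Sum.inl l') ≠ 0) :
    w ∈ Fintype.piFinset (fun i => Finset.Icc (y i - ((2 * Lc : ℕ) : ℤ)) (y i + ((2 * Lc : ℕ) : ℤ))) ∧
      u ∈ Fintype.piFinset (fun i => Finset.Icc (y i - ((2 * Lc : ℕ) : ℤ)) (y i + ((2 * Lc : ℕ) : ℤ))) := by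
  have hL1 : 1 ≤ Lc := Nat.one_le_iff_ne_zero.mpr (NeZero.ne Lc)
  by_cases hu : Torus.proj Lc u = 0
  · have e := OneStepResolventKernel.eq_zsmul_quo_of_proj (N := Lc) hu
    simp only [onLat, hu, if_true, Pi.neg_apply, ne_eq, neg_eq_zero, AveragingHessianKernels.hessFF_inl_inl] at h
    have hw : Near Lc (quo Lc u) w := by
      by_contra hn
      exact h (AveragingHessianKernels.hessKer_eq_zero_left (f := (l, w)) hn _)
    have hy : Near Lc (quo Lc u) y := by
      by_contra hn
      exact h (AveragingHessianKernels.hessKer_eq_zero_right (l, w) (f' := (l', y)) hn)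
    have hc : (((2 * Lc : ℕ) : ℤ)) = 2 * (Lc : ℤ) := by push_cast; ring
    refine ⟨mem_colBox_iff.mpr fun i => ?_, mem_colBox_iff.mpr fun i => ?_⟩
    · obtain ⟨h1, h2⟩ := hw i
      obtain ⟨h3, h4⟩ := hy i
      rw [hc]; constructor <;> omega
    · obtain ⟨h3, h4⟩ := hy i
      have hui : u i = (Lc : ℤ) * quo Lc u i := by
        have := congrFun e i
        simpa only [Pi.smul_apply, smul_eq_mul] using this
      rw [hc, hui]; constructor <;> omega
  · exact absurd (by rw [onLat_off _ hu]; rfl) h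

omit [NeZero Lc] in
/-- [folklore] The synthetic table is bounded by `2ℓ²`, `ℓ = ell (d+1) Lc` (`abs_hessKer_le`). -/
theorem abs_onLat_hessFF_le (hLc : 1 ≤ Lc) (μ : Fin (d + 1)) (u w y : Fin (d + 1) → ℤ) (l l' : Fin (d + 1)) :
    |onLat Lc (fun yy => -hessFF Lc μ yy) u w y (Sum.inl l) (Sum.inl l')| ≤ 2 * (ell (d + 1) Lc : ℝ) ^ 2 := by
  by_cases hu : Torus.proj Lc u = 0
  · simp only [onLat, hu, if_true, Pi.neg_apply, abs_neg, AveragingHessianKernels.hessFF_inl_inl]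
    exact AveragingHessianKernels.abs_hessKer_le hLc μ _ _ _
  · rw [onLat_off _ hu]
    show |(0 : ℝ)| ≤ _
    rw [abs_zero]; positivity

omit [NeZero Lc] in
/-- [folklore] **BOUNDED COLUMN MASS** of the synthetic table (the `hmass` of `TaylorSandwich.sandwich_bound`), `N`-free and level-free:
`Σ_{w ∈ box y} Σ_l Σ_μ Σ_{u ∈ box y} |T′ μ u w l y l′| ≤ (4Lc+1)^{2(d+1)}·(d+1)²·2ℓ²`. -/
theorem mass_onLat_hessFF (hLc : 1 ≤ Lc) (y : Fin (d + 1) → ℤ) (l' : Fin (d + 1)) :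
    ∑ w ∈ Fintype.piFinset (fun i => Finset.Icc (y i - ((2 * Lc : ℕ) : ℤ)) (y i + ((2 * Lc : ℕ) : ℤ))),
      ∑ l : Fin (d + 1), ∑ μ : Fin (d + 1),
        ∑ u ∈ Fintype.piFinset (fun i => Finset.Icc (y i - ((2 * Lc : ℕ) : ℤ)) (y i + ((2 * Lc : ℕ) : ℤ))),
          |onLat Lc (fun yy => -hessFF Lc μ yy) u w y (Sum.inl l) (Sum.inl l')| ≤
      ((2 * (2 * Lc) + 1) ^ (d + 1) : ℕ) * ((d + 1) * ((d + 1) * (((2 * (2 * Lc) + 1) ^ (d + 1) : ℕ) *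
        (2 * (ell (d + 1) Lc : ℝ) ^ 2)))) := by
  have hcard := card_colBox (d := d) (R := 2 * Lc) y
  calc _ ≤ ∑ _w ∈ Fintype.piFinset (fun i => Finset.Icc (y i - ((2 * Lc : ℕ) : ℤ)) (y i + ((2 * Lc : ℕ) : ℤ))),
        ∑ _l : Fin (d + 1), ∑ _μ : Fin (d + 1),
          ∑ _u ∈ Fintype.piFinset (fun i => Finset.Icc (y i - ((2 * Lc : ℕ) : ℤ)) (y i + ((2 * Lc : ℕ) : ℤ))),
            (2 * (ell (d + 1) Lc : ℝ) ^ 2) :=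
        Finset.sum_le_sum fun w _ => Finset.sum_le_sum fun l _ => Finset.sum_le_sum fun μ _ =>
          Finset.sum_le_sum fun u _ => abs_onLat_hessFF_le hLc μ u w y l l'
    _ = _ := by
        simp only [Finset.sum_const, Finset.card_univ, Fintype.card_fin, nsmul_eq_mul, hcard]
        push_cast
        ring

omit [NeZero N] in
/-- [folklore] **THE SYNTHETIC VERTEX LEG IS THE BRACKET BOUND**: a bound `|ν·β(μ,yy)| ≤ CH·e^{−κ|quo N (Lc•yy) − u′|₁}` at the coarse
bonds is literally the `hH` hypothesis of `TaylorSandwich.sandwich_bound` for `H′ μ u := onLat Lc (yy ↦ ν·β(μ,yy)) u`. -/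
theorem leg_onLat {β : Fin (d + 1) → (Fin (d + 1) → ℤ) → ℝ} {CH κ : ℝ} {u' : Fin (d + 1) → ℤ} (hCH : 0 ≤ CH)
    (hβ : ∀ μ yy, |β μ yy| ≤ CH * Real.exp (-κ * l1 (quo N ((Lc : ℤ) • yy) - u'))) (μ : Fin (d + 1))
    (u : Fin (d + 1) → ℤ) : |onLat Lc (β μ) u| ≤ CH * Real.exp (-κ * l1 (quo N u - u')) := by
  by_cases hu : Torus.proj Lc u = 0
  · have e := OneStepResolventKernel.eq_zsmul_quo_of_proj (N := Lc) hu
    simp only [onLat, hu, if_true]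
    have h := hβ μ (quo Lc u)
    rwa [← e] at h
  · rw [onLat_off _ hu, abs_zero]; positivity

end Synthetic

end Summit.QuantumFields.BalabanUV.Beta.GAN24.S3ShapeL0Contraction

end
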